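import Summits.BirchSwinnertonDyer.BirchSwinnertonDyer.Theorems.SignedLowerHalvesKobayashiLowerHalfLargeImageCongruenceShape
import Summits.BirchSwinnertonDyer.Rank1Residual.Supersingular.MazurTateCertificates
import HarnessLib

/-!
# Route `SignedLowerHalves`, crux `KobayashiLowerHalfLargeImage` (item stmt-BirchSwinnertonDyer-19001):
# the congruence road READ OFF MAZUR–TATE CERTIFICATES — the target's `(μ, λ)(L^ε_p) = (0, l)` and a
# tight partner's `λ(X^ε) = 1` from ONE two-engine Mazur–Tate element each (cell `bsd-ssimc`, seat
# `bsd-ssimc-k3-c3` gen 6; `--supports stmt-BirchSwinnertonDyer-19001 --as helper`; closes nothing)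

PARTITION (cell bsd-ssimc): X7 (A7) × item 3's rank-ONE window OFF the tight Mazur–Tate rows —
closes PER PAIR only (records `congl_*` are separate files); crux OPEN; nothing booked; BSD is not
proved by any of this. THEOREMS ONLY; no definition, no named fact, nothing about any curve asserted.

Companion of `…CongruenceShape.lean` (p463555, the road `kobayashiMainConjecture_of_lambdaTransfer`).
That theorem takes the target's certificate `hcert` for newforms of EVERY level; a Mazur–Tate row
certifies the newform `f₀` of level `N_E` only, which is all the conjecture quantifies over
(`IsNewformOf.unique`, as in b2b's `kobayashiMainConjecture_of_cert_at_conductor_of_analyticRank_eq_one`).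
So this file (§1) re-runs the road with the certificate AT THE CONDUCTOR, (§2) reads that certificate
off ONE Mazur–Tate element by the tree's `lam_signed_neg_one/one_eq_of_mazurTate'` — SIGN DICTIONARY
as in the companion: odd layer `n`, `λ(Θ) = deg ω_n^+ + l` ↦ `ε = −1` (tree `L⁺ = L♯`); even `n`,
`λ(Θ) = deg ω_n^- + l` ↦ `ε = 1` (`L⁻ = L♭`) —, and (§3) supplies the TIGHT partner's
`λ(X^ε(E′/ℚ_∞)) = 1` from ITS Mazur–Tate row (`λ(Θ′) = deg ω_n^± + 1`, `r_an(E′) = 1`, Kato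
`ξ′ ∣ L′` and (C) `T ∣ ξ′`), in the `hlam′` shape the road consumes. The unit-zone partner's
`λ = 0` is the companion's `lambdaInvariant_eq_zero_of_padicValRat_lRatio_eq_zero`.

References: [Kobayashi2003] Conj. (p. 2), Thm. 1.2, 4.1; [BDKim2009] Cor. 2.13, 2.5, Prop. 2.6;
[Pollack2003] Def. 6.15, Prop. 6.9/6.10/6.18; [GreenbergVatsal2000] Prop. (2.4), p. 4; [Wuthrich2014] L. 20.
-/

set_option autoImplicit false
set_option linter.dupNamespace false
noncomputable section

open scoped Classical MatrixGroups ModularForm BigOperators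

open CongruenceSubgroup WeierstrassCurve NumberField IsDedekindDomain
  Literature.NumberTheory.EllipticCurves
  Literature.NumberTheory.EllipticCurves.ModularForms
  Literature.NumberTheory.EllipticCurves.Rank1Residual
  Literature.NumberTheory.EllipticCurves.Rank1Residual.Typed
  Literature.NumberTheory.EllipticCurves.Kobayashi2003 ZpExtension
  Literature.NumberTheory.EllipticCurves.GreenbergVatsal2000
  Summit.BirchSwinnertonDyer.Rank1Residual.X1.MuLambda
  Summit.BirchSwinnertonDyer.Rank1Residual.Supersingular

namespace Summit.BirchSwinnertonDyer.BirchSwinnertonDyer.Theorems.CongruenceRoad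

variable {W : WeierstrassCurve ℚ} [W.IsElliptic] [W.IsGloballyMinimal] {p : ℕ} [Fact p.Prime]

/-! ### §1 The road with the target's certificate at the conductor -/

/-- **The congruence road, certificate AT THE CONDUCTOR.** As
`kobayashiMainConjecture_of_lambdaTransfer`, but the target's two-engine certificate is stated for ONE
newform `f₀` of level `N_E` (`hcert₀`): the conjecture's quantifier ranges over newforms of `W` of
level `N_E`, all equal to `f₀` (`IsNewformOf.unique`). PER PAIR; closes nothing.
[cite: Kobayashi2003, Thm. 1.2, Thm. 4.1 (p. 8) and Conjecture (p. 2)] [cite: BDKim2009, Cor. 2.13, Cor. 2.5 and Prop. 2.6 (pp. 185–187)]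
[cite: GreenbergVatsal2000, p. 4 and §2 Prop. (2.4)] [cite: Wuthrich2014, Lemma 20 (p. 399)] -/
theorem kobayashiMainConjecture_of_lambdaTransfer_at_conductor
    (h12 : Kobayashi2003.thm12_signedSelmerDual_finite_torsion)
    (h41 : Kobayashi2003.thm41_signedCharIdeal_divisibility)
    (h5 : realPeriodRat_eq_unit_mul_plusPeriod) (h3 : realPeriodRat_eq_unit_mul_plusPeriod_three)
    (hL20 : Wuthrich2014.lemma20_surjective_threeAdic_of_semistable)
    (hKim : BDKim2009.cor213_signedLambda_add_sum_delta_eq_of_torsionIso)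
    (hp : p ≠ 2) (hgood : W.HasGoodReductionAtPrime p) (hap : W.frobeniusTrace p = 0)
    (hs : Surj W p) (ε : ℤˣ) {l : ℕ}
    [NeZero (W.conductorNorm ℤ)] {f₀ : CuspForm (Gamma0 (W.conductorNorm ℤ)) 2} (hf₀ : IsNewformOf W f₀)
    (hcert₀ : ∀ L : IwasawaAlgebra p, IsSignedPAdicLFunction f₀ p ε L → mu L = 0 ∧ lam L = l)
    {W' : WeierstrassCurve ℚ} [W'.IsElliptic] [W'.IsGloballyMinimal]
    (hgood' : W'.HasGoodReductionAtPrime p) (hap' : W'.frobeniusTrace p = 0)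
    (he : ∃ e : geomTorsion W (p : ℤ) ≃+ geomTorsion W' (p : ℤ),
      ∀ (σ : Field.absoluteGaloisGroup ℚ) (P : geomTorsion W (p : ℤ)), e (σ • P) = σ • e P)
    {l' : ℕ}
    (hlam' : ∀ (κ : ZpExtension ℚ p) (γ : Field.absoluteGaloisGroup ℚ), κ.IsCyclotomic →
      κ.IsTopGenerator γ → IsCyclotomicVariable p γ → ∀ (D' : SignedSelmerDualData W' κ γ ε)
      [Module.Finite (IwasawaAlgebra p) D'.X], Module.IsTorsion (IwasawaAlgebra p) D'.X →
      lambdaInvariant p D'.X = l')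
    (S₀ : Finset (HeightOneSpectrum (𝓞 ℚ))) (hS₀ : ∀ v ∈ S₀, ((p : ℕ) : 𝓞 ℚ) ∉ v.asIdeal)
    (hS₀W : ∀ v : HeightOneSpectrum (𝓞 ℚ), ¬ W.HasGoodReductionAt v → v ∈ S₀)
    (hS₀W' : ∀ v : HeightOneSpectrum (𝓞 ℚ), ¬ W'.HasGoodReductionAt v → v ∈ S₀)
    (hδ : l + ∑ v ∈ S₀, delta W p v = l' + ∑ v ∈ S₀, delta W' p v) :
    KobayashiMainConjecture W p ε := by
  intro κ γ hκ hγ hγ' _ f hf ϖ hϖ Lplus Lminus hPP D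
  -- the newform of the quantifier is `f₀`
  have hff : f = f₀ := hf.unique hf₀
  subst hff
  haveI : Module.Finite (IwasawaAlgebra p) D.X := h12.moduleFinite hp hgood hap hκ hγ D
  have hX : Module.IsTorsion (IwasawaAlgebra p) D.X := h12.isTorsion hp hgood hap hκ hγ D
  refine ⟨hX, ?_⟩
  obtain ⟨ξ, hξ⟩ := (charIdeal_isPrincipal_holds p D.X).principal
  have hξ' : D.charIdeal = Ideal.span {ξ} := hξ
  set L := kobayashiL ε Lplus Lminus with hL_def
  have hL : IsSignedPAdicLFunction f p ε L := hPP.isSignedPAdicLFunction_kobayashiL ε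
  have hsurj : ∀ m : ℕ, W.HasSurjectiveModNGaloisRep (p ^ m : ℕ) :=
    surjective_pow_of_surj_of_good W p hL20 hp hgood hs
  have hU : ξ ∣ L := h41.dvd_of_charIdeal_eq_span hp hgood hap hf hκ hγ hγ' hL D hX hsurj hξ'
  obtain ⟨hμL, hlamL⟩ := hcert₀ L hL
  have hL0 : L ≠ 0 := by
    rw [hL_def]
    unfold kobayashiL
    split_ifs
    · exact hPP.2.1
    · exact hPP.1
  obtain ⟨h, hfac⟩ := hU
  have hξ0 : ξ ≠ 0 := by
    rintro rfl
    exact hL0 (by rw [hfac, zero_mul])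
  have hh0 : h ≠ 0 := by
    rintro rfl
    exact hL0 (by rw [hfac, mul_zero])
  have hμξ : mu ξ = 0 := by
    have hle := mu_le_mu_mul hξ0 hh0
    rw [← hfac, hμL] at hle
    omega
  have hDmu : D.mu = 0 := by
    show muInvariant p D.X = 0
    rw [← Summit.BirchSwinnertonDyer.Rank1Residual.X1.MuPart.mu_generator_eq_muInvariant D.X hX hξ0 hξ]
    exact hμξ
  obtain ⟨D'⟩ := nonempty_signedSelmerDualData W' κ ε hγ
  haveI : Module.Finite (IwasawaAlgebra p) D'.X := h12.moduleFinite hp hgood' hap' hκ hγ D'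
  have hX' : Module.IsTorsion (IwasawaAlgebra p) D'.X := h12.isTorsion hp hgood' hap' hκ hγ D'
  have hlamD' : lambdaInvariant p D'.X = l' := hlam' κ γ hκ hγ hγ' D' hX'
  have hT := hKim W W' p hp hgood hap hgood' hap' he κ γ hκ hγ S₀ hS₀ hS₀W hS₀W' ε D D' hX hX' hDmu
  have hlamD : lambdaInvariant p D.X = l := by
    rw [hlamD'] at hT
    omega
  have hlamξ : lam ξ = l := by
    rw [Summit.BirchSwinnertonDyer.Rank1Residual.X1.ParitySqueeze.lam_generator_eq_lambdaInvariant D.X hX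
      hξ0 hξ, hlamD]
  have hspan : Ideal.span ({ξ} : Set (IwasawaAlgebra p)) = Ideal.span {L} :=
    ((span_eq_span_iff_mu_le_and_lam_le hξ0 hL0 hfac).mpr
      ⟨by rw [hμL]; exact Nat.zero_le _, by rw [hlamL, hlamξ]⟩).symm
  have hirr : W.HasIrreducibleModPGaloisRep p :=
    hasIrreducibleModPGaloisRep_of_dvd_frobeniusTrace W p hp
      (W.not_dvd_minimalDiscriminantInt_of_hasGoodReductionAtPrime' p hgood) (by rw [hap]; exact dvd_zero _)
  have hvϖ : padicValRat p ϖ = 0 := padicValRat_periodRatio_eq_zero h5 h3 W p hp hgood hirr f hf ϖ hϖ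
  have hϖ0 : ϖ ≠ 0 := by
    intro h0
    rw [h0, Rat.cast_zero, zero_mul] at hϖ
    exact (IsNewform0.plusPeriod_pos_holds hf.1 hf.coeffField_eq_bot).ne' hϖ.symm
  obtain ⟨u, hu⟩ := exists_units_coe_eq_ratCast hϖ0 hvϖ
  obtain ⟨hspan', hι⟩ := span_C_units_mul_eq u L
  refine ⟨PowerSeries.C (u : ℤ_[p]) * L, ?_, ?_⟩
  · rw [hξ', hspan, hspan']
  · rw [hι, hu]

/-! ### §2 The target's certificate read off ONE Mazur–Tate element -/

/-- **The congruence road from an ODD-layer Mazur–Tate certificate (`ε = −1`, the tree's `L⁺`).**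
Data: the newform `f₀` of `E = W`, `n` odd, `Θ ∈ Λ` with `ι Θ = θ_n(f₀)` (two engines), `Θ ≠ 0`,
`μ(Θ) = 0`, `λ(Θ) = deg ω_n^+ + l` — by `lam_signed_neg_one_eq_of_mazurTate'` this IS
`(μ, λ)(L^{−1}_p(E)) = (0, l)` —; the partner's `hlam′`, `S₀`, `hδ` as in §1. Conclusion
`KobayashiMainConjecture W p (-1)`. PER PAIR. [cite: Pollack2003, Def. 6.15, Prop. 6.9, 6.10 and 6.18]
[cite: Kobayashi2003, Thm. 4.1 (p. 8) and Conjecture (p. 2)] [cite: BDKim2009, Cor. 2.13 (p. 187)] -/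
theorem kobayashiMainConjecture_neg_one_of_lambdaTransfer_of_mazurTate
    (h12 : Kobayashi2003.thm12_signedSelmerDual_finite_torsion)
    (h41 : Kobayashi2003.thm41_signedCharIdeal_divisibility)
    (h5 : realPeriodRat_eq_unit_mul_plusPeriod) (h3 : realPeriodRat_eq_unit_mul_plusPeriod_three)
    (hL20 : Wuthrich2014.lemma20_surjective_threeAdic_of_semistable)
    (hKim : BDKim2009.cor213_signedLambda_add_sum_delta_eq_of_torsionIso)
    (hp : p ≠ 2) (hgood : W.HasGoodReductionAtPrime p) (hap : W.frobeniusTrace p = 0)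
    (hs : Surj W p) {l : ℕ}
    [NeZero (W.conductorNorm ℤ)] {f₀ : CuspForm (Gamma0 (W.conductorNorm ℤ)) 2} (hf₀ : IsNewformOf W f₀)
    {n : ℕ} (hn : Odd n) {Θ : IwasawaAlgebra p}
    (hΘ : iwasawaToPowerSeries p Θ =
      ((mazurTateElement f₀ p n).map (algebraMap ℚ ℚ_[p]) : PowerSeries ℚ_[p]))
    (hΘ0 : Θ ≠ 0) (hμ : mu Θ = 0) (hlam : lam Θ = (cyclotomicOmegaPlus p n).natDegree + l)
    {W' : WeierstrassCurve ℚ} [W'.IsElliptic] [W'.IsGloballyMinimal]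
    (hgood' : W'.HasGoodReductionAtPrime p) (hap' : W'.frobeniusTrace p = 0)
    (he : ∃ e : geomTorsion W (p : ℤ) ≃+ geomTorsion W' (p : ℤ),
      ∀ (σ : Field.absoluteGaloisGroup ℚ) (P : geomTorsion W (p : ℤ)), e (σ • P) = σ • e P)
    {l' : ℕ}
    (hlam' : ∀ (κ : ZpExtension ℚ p) (γ : Field.absoluteGaloisGroup ℚ), κ.IsCyclotomic →
      κ.IsTopGenerator γ → IsCyclotomicVariable p γ → ∀ (D' : SignedSelmerDualData W' κ γ (-1))
      [Module.Finite (IwasawaAlgebra p) D'.X], Module.IsTorsion (IwasawaAlgebra p) D'.X →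
      lambdaInvariant p D'.X = l')
    (S₀ : Finset (HeightOneSpectrum (𝓞 ℚ))) (hS₀ : ∀ v ∈ S₀, ((p : ℕ) : 𝓞 ℚ) ∉ v.asIdeal)
    (hS₀W : ∀ v : HeightOneSpectrum (𝓞 ℚ), ¬ W.HasGoodReductionAt v → v ∈ S₀)
    (hS₀W' : ∀ v : HeightOneSpectrum (𝓞 ℚ), ¬ W'.HasGoodReductionAt v → v ∈ S₀)
    (hδ : l + ∑ v ∈ S₀, delta W p v = l' + ∑ v ∈ S₀, delta W' p v) :
    KobayashiMainConjecture W p (-1) :=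
  kobayashiMainConjecture_of_lambdaTransfer_at_conductor h12 h41 h5 h3 hL20 hKim hp hgood hap hs (-1) hf₀
    (fun _ hL ↦ lam_signed_neg_one_eq_of_mazurTate' hp hf₀ hgood hap hL hn hΘ hΘ0 hμ hlam)
    hgood' hap' he hlam' S₀ hS₀ hS₀W hS₀W' hδ

/-- **The congruence road from an EVEN-layer Mazur–Tate certificate (`ε = 1`, the tree's `L⁻`)**:
`n` even, `λ(Θ) = deg ω_n^- + l`. PER PAIR. [cite: Pollack2003, Def. 6.15, Prop. 6.9, 6.10 and 6.18]
[cite: Kobayashi2003, Thm. 4.1 (p. 8) and Conjecture (p. 2)] [cite: BDKim2009, Cor. 2.13 (p. 187)] -/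
theorem kobayashiMainConjecture_one_of_lambdaTransfer_of_mazurTate
    (h12 : Kobayashi2003.thm12_signedSelmerDual_finite_torsion)
    (h41 : Kobayashi2003.thm41_signedCharIdeal_divisibility)
    (h5 : realPeriodRat_eq_unit_mul_plusPeriod) (h3 : realPeriodRat_eq_unit_mul_plusPeriod_three)
    (hL20 : Wuthrich2014.lemma20_surjective_threeAdic_of_semistable)
    (hKim : BDKim2009.cor213_signedLambda_add_sum_delta_eq_of_torsionIso)
    (hp : p ≠ 2) (hgood : W.HasGoodReductionAtPrime p) (hap : W.frobeniusTrace p = 0)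
    (hs : Surj W p) {l : ℕ}
    [NeZero (W.conductorNorm ℤ)] {f₀ : CuspForm (Gamma0 (W.conductorNorm ℤ)) 2} (hf₀ : IsNewformOf W f₀)
    {n : ℕ} (hn : Even n) {Θ : IwasawaAlgebra p}
    (hΘ : iwasawaToPowerSeries p Θ =
      ((mazurTateElement f₀ p n).map (algebraMap ℚ ℚ_[p]) : PowerSeries ℚ_[p]))
    (hΘ0 : Θ ≠ 0) (hμ : mu Θ = 0) (hlam : lam Θ = (cyclotomicOmegaMinus p n).natDegree + l)
    {W' : WeierstrassCurve ℚ} [W'.IsElliptic] [W'.IsGloballyMinimal]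
    (hgood' : W'.HasGoodReductionAtPrime p) (hap' : W'.frobeniusTrace p = 0)
    (he : ∃ e : geomTorsion W (p : ℤ) ≃+ geomTorsion W' (p : ℤ),
      ∀ (σ : Field.absoluteGaloisGroup ℚ) (P : geomTorsion W (p : ℤ)), e (σ • P) = σ • e P)
    {l' : ℕ}
    (hlam' : ∀ (κ : ZpExtension ℚ p) (γ : Field.absoluteGaloisGroup ℚ), κ.IsCyclotomic →
      κ.IsTopGenerator γ → IsCyclotomicVariable p γ → ∀ (D' : SignedSelmerDualData W' κ γ 1)
      [Module.Finite (IwasawaAlgebra p) D'.X], Module.IsTorsion (IwasawaAlgebra p) D'.X →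
      lambdaInvariant p D'.X = l')
    (S₀ : Finset (HeightOneSpectrum (𝓞 ℚ))) (hS₀ : ∀ v ∈ S₀, ((p : ℕ) : 𝓞 ℚ) ∉ v.asIdeal)
    (hS₀W : ∀ v : HeightOneSpectrum (𝓞 ℚ), ¬ W.HasGoodReductionAt v → v ∈ S₀)
    (hS₀W' : ∀ v : HeightOneSpectrum (𝓞 ℚ), ¬ W'.HasGoodReductionAt v → v ∈ S₀)
    (hδ : l + ∑ v ∈ S₀, delta W p v = l' + ∑ v ∈ S₀, delta W' p v) :
    KobayashiMainConjecture W p 1 :=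
  kobayashiMainConjecture_of_lambdaTransfer_at_conductor h12 h41 h5 h3 hL20 hKim hp hgood hap hs 1 hf₀
    (fun _ hL ↦ lam_signed_one_eq_of_mazurTate' hp hf₀ hgood hap hL hn hΘ hΘ0 hμ hlam)
    hgood' hap' he hlam' S₀ hS₀ hS₀W hS₀W' hδ

/-! ### §3 The TIGHT partner's `λ(X^ε) = 1` read off its own Mazur–Tate row -/

/-- **Tight rank-one partner, certificate at the conductor.** For `E′ = W′` with `p` odd good,
`a_p = 0`, `ρ̄_{E′,p}` onto, `r_an(E′) = 1`, its newform `f₀′` and `(μ, λ)(L′^ε) = (0, 1)` certified for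
`f₀′`: every dual datum `D′` of `Sel^ε(E′/ℚ_∞)` has `λ(D′.X) = 1` — Kato `ξ′ ∣ L′`, (C) `T ∣ ξ′`,
GZK. PER PAIR. [cite: Kobayashi2003, Thm. 4.1 (p. 8)] [cite: GreenbergVatsal2000, p. 4] [cite: Wuthrich2014, Lemma 20 (p. 399)] -/
theorem lambdaInvariant_eq_one_of_cert_at_conductor_of_analyticRank_eq_one
    (h41 : Kobayashi2003.thm41_signedCharIdeal_divisibility)
    (hL20 : Wuthrich2014.lemma20_surjective_threeAdic_of_semistable)
    (hGZK : rank_eq_analyticRank_of_analyticRank_le_one)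
    {W' : WeierstrassCurve ℚ} [W'.IsElliptic] [W'.IsGloballyMinimal]
    (hPollack : ∀ {N : ℕ} [NeZero N] {f : CuspForm (Gamma0 N) 2},
      pollack_exists_plusMinusPAdicLFunction (W := W') (f := f) (p := p))
    (hp : p ≠ 2) (hgood' : W'.HasGoodReductionAtPrime p) (hap' : W'.frobeniusTrace p = 0)
    (hs' : Surj W' p) (h1 : W'.analyticRank = 1) (ε : ℤˣ)
    [NeZero (W'.conductorNorm ℤ)] {f₀ : CuspForm (Gamma0 (W'.conductorNorm ℤ)) 2} (hf₀ : IsNewformOf W' f₀)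
    (hcert₀ : ∀ L : IwasawaAlgebra p, IsSignedPAdicLFunction f₀ p ε L → mu L = 0 ∧ lam L = 1) :
    ∀ (κ : ZpExtension ℚ p) (γ : Field.absoluteGaloisGroup ℚ), κ.IsCyclotomic →
      κ.IsTopGenerator γ → IsCyclotomicVariable p γ → ∀ (D' : SignedSelmerDualData W' κ γ ε)
      [Module.Finite (IwasawaAlgebra p) D'.X], Module.IsTorsion (IwasawaAlgebra p) D'.X →
      lambdaInvariant p D'.X = 1 := by
  intro κ γ hκ hγ hγ' D' _ hX'
  obtain ⟨Lplus, Lminus, hPP⟩ := exists_isPollackPair hPollack hp hf₀ hgood' hap'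
  set L := kobayashiL ε Lplus Lminus with hL_def
  have hL : IsSignedPAdicLFunction f₀ p ε L := hPP.isSignedPAdicLFunction_kobayashiL ε
  obtain ⟨ξ, hξ⟩ := (charIdeal_isPrincipal_holds p D'.X).principal
  have hξ' : D'.charIdeal = Ideal.span {ξ} := hξ
  have hsurj : ∀ m : ℕ, W'.HasSurjectiveModNGaloisRep (p ^ m : ℕ) :=
    surjective_pow_of_surj_of_good W' p hL20 hp hgood' hs'
  have hU : ξ ∣ L := h41.dvd_of_charIdeal_eq_span hp hgood' hap' hf₀ hκ hγ hγ' hL D' hX' hsurj hξ'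
  have hC := D'.X_pow_mordellWeilRank_dvd_of_charIdeal_eq_span hγ hX' hξ'
  have hrank : W'.mordellWeilRank = 1 := (hGZK W' (by omega)).1.trans h1
  rw [hrank] at hC
  obtain ⟨hμ, hlam⟩ := hcert₀ L hL
  have hL0 : L ≠ 0 := ne_zero_of_lam_ne_zero (by rw [hlam]; exact one_ne_zero)
  obtain ⟨h, hfac⟩ := hU
  have hξ0 : ξ ≠ 0 := by
    rintro rfl
    exact hL0 (by rw [hfac, zero_mul])
  have hh0 : h ≠ 0 := by
    rintro rfl
    exact hL0 (by rw [hfac, mul_zero])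
  have hge : 1 ≤ lam ξ := Summit.BirchSwinnertonDyer.Rank1Residual.X2.le_lam_of_X_pow_dvd hξ0 hC
  have hle : lam ξ ≤ 1 := by
    have := lam_le_lam_mul hξ0 hh0
    rw [← hfac, hlam] at this
    exact this
  rw [← Summit.BirchSwinnertonDyer.Rank1Residual.X1.ParitySqueeze.lam_generator_eq_lambdaInvariant D'.X hX'
    hξ0 hξ]
  omega

/-- **Tight partner from an ODD-layer Mazur–Tate row** (`ε = −1`: `n` odd, `λ(Θ′) = deg ω_n^+ + 1`;
b2b `MazurTateRecordsBWX7RankOne*` / `X7Three` rows with `lamL = 1`, `odd = true`): `λ(X^{−1}(E′)) = 1`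
for every dual datum. PER PAIR. [cite: Pollack2003, Def. 6.15, Prop. 6.9, 6.10 and 6.18]
[cite: Kobayashi2003, Thm. 4.1 (p. 8)] -/
theorem lambdaInvariant_eq_one_of_mazurTate_neg_one_of_analyticRank_eq_one
    (h41 : Kobayashi2003.thm41_signedCharIdeal_divisibility)
    (hL20 : Wuthrich2014.lemma20_surjective_threeAdic_of_semistable)
    (hGZK : rank_eq_analyticRank_of_analyticRank_le_one)
    {W' : WeierstrassCurve ℚ} [W'.IsElliptic] [W'.IsGloballyMinimal]
    (hPollack : ∀ {N : ℕ} [NeZero N] {f : CuspForm (Gamma0 N) 2},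
      pollack_exists_plusMinusPAdicLFunction (W := W') (f := f) (p := p))
    (hp : p ≠ 2) (hgood' : W'.HasGoodReductionAtPrime p) (hap' : W'.frobeniusTrace p = 0)
    (hs' : Surj W' p) (h1 : W'.analyticRank = 1)
    [NeZero (W'.conductorNorm ℤ)] {f₀ : CuspForm (Gamma0 (W'.conductorNorm ℤ)) 2} (hf₀ : IsNewformOf W' f₀)
    {n : ℕ} (hn : Odd n) {Θ : IwasawaAlgebra p}
    (hΘ : iwasawaToPowerSeries p Θ =
      ((mazurTateElement f₀ p n).map (algebraMap ℚ ℚ_[p]) : PowerSeries ℚ_[p]))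
    (hΘ0 : Θ ≠ 0) (hμ : mu Θ = 0) (hlam : lam Θ = (cyclotomicOmegaPlus p n).natDegree + 1) :
    ∀ (κ : ZpExtension ℚ p) (γ : Field.absoluteGaloisGroup ℚ), κ.IsCyclotomic →
      κ.IsTopGenerator γ → IsCyclotomicVariable p γ → ∀ (D' : SignedSelmerDualData W' κ γ (-1))
      [Module.Finite (IwasawaAlgebra p) D'.X], Module.IsTorsion (IwasawaAlgebra p) D'.X →
      lambdaInvariant p D'.X = 1 :=
  lambdaInvariant_eq_one_of_cert_at_conductor_of_analyticRank_eq_one h41 hL20 hGZK hPollack hp hgood' hap'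
    hs' h1 (-1) hf₀ (fun _ hL ↦ lam_signed_neg_one_eq_of_mazurTate' hp hf₀ hgood' hap' hL hn hΘ hΘ0 hμ hlam)

/-- **Tight partner from an EVEN-layer Mazur–Tate row** (`ε = 1`: `n` even, `λ(Θ′) = deg ω_n^- + 1`).
PER PAIR. [cite: Pollack2003, Def. 6.15, Prop. 6.9, 6.10 and 6.18] [cite: Kobayashi2003, Thm. 4.1 (p. 8)] -/
theorem lambdaInvariant_eq_one_of_mazurTate_one_of_analyticRank_eq_one
    (h41 : Kobayashi2003.thm41_signedCharIdeal_divisibility)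
    (hL20 : Wuthrich2014.lemma20_surjective_threeAdic_of_semistable)
    (hGZK : rank_eq_analyticRank_of_analyticRank_le_one)
    {W' : WeierstrassCurve ℚ} [W'.IsElliptic] [W'.IsGloballyMinimal]
    (hPollack : ∀ {N : ℕ} [NeZero N] {f : CuspForm (Gamma0 N) 2},
      pollack_exists_plusMinusPAdicLFunction (W := W') (f := f) (p := p))
    (hp : p ≠ 2) (hgood' : W'.HasGoodReductionAtPrime p) (hap' : W'.frobeniusTrace p = 0)
    (hs' : Surj W' p) (h1 : W'.analyticRank = 1)
    [NeZero (W'.conductorNorm ℤ)] {f₀ : CuspForm (Gamma0 (W'.conductorNorm ℤ)) 2} (hf₀ : IsNewformOf W' f₀)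
    {n : ℕ} (hn : Even n) {Θ : IwasawaAlgebra p}
    (hΘ : iwasawaToPowerSeries p Θ =
      ((mazurTateElement f₀ p n).map (algebraMap ℚ ℚ_[p]) : PowerSeries ℚ_[p]))
    (hΘ0 : Θ ≠ 0) (hμ : mu Θ = 0) (hlam : lam Θ = (cyclotomicOmegaMinus p n).natDegree + 1) :
    ∀ (κ : ZpExtension ℚ p) (γ : Field.absoluteGaloisGroup ℚ), κ.IsCyclotomic →
      κ.IsTopGenerator γ → IsCyclotomicVariable p γ → ∀ (D' : SignedSelmerDualData W' κ γ 1)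
      [Module.Finite (IwasawaAlgebra p) D'.X], Module.IsTorsion (IwasawaAlgebra p) D'.X →
      lambdaInvariant p D'.X = 1 :=
  lambdaInvariant_eq_one_of_cert_at_conductor_of_analyticRank_eq_one h41 hL20 hGZK hPollack hp hgood' hap'
    hs' h1 1 hf₀ (fun _ hL ↦ lam_signed_one_eq_of_mazurTate' hp hf₀ hgood' hap' hL hn hΘ hΘ0 hμ hlam)

end Summit.BirchSwinnertonDyer.BirchSwinnertonDyer.Theorems.CongruenceRoad

end
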